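import Summits.Ventures.QEC.Census.LP.LP144w5d12.BZKernelZ8
import Summits.Ventures.QEC.Census.CertBZPlaneSound
import Summits.Ventures.QEC.Census.CertBZInfoSets
import Summits.Ventures.QEC.Census.CertChunks
import Summits.Ventures.QEC.Census.LP.LP144w5d12.Cert
import HarnessLib

/-!
# `LP144w5d12` — `Z`-side Brouwer–Zimmermann replay, file BZKernelZ13: units b1m1s17 … b1m1s20 (b = block, m = matrix; h = head, s = lane segment, e = matrix verdict, t = block verdict) (tier KERNEL; lane engine for the enumeration)

census row `LPb_2x2_l36_b0-1-11_E0-0.0-3` (family LP) is `[[144, 4, 12]]`.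
Per block `b` of `LP144w5d12.bzData.sideZ`: systematic forms `sysZ_b_i` (`DistCert.bzZSys`), the recounted bound `boundZ_b`
(`bzZBound`), lane segments `psegZ_b_i_k` (`Plane.segOK`, type-01's lane-parallel Brouwer–Zimmermann replay, `Census/CertBZPlane*.lean`),
the enumeration verdicts `enumZ_b_i` (`DistCert.bzZEnum_of_reaches` + `Plane.reaches_of_segList`) and the block verdict `blkZ_b`
(`DistCert.bzZBlock_of_parts`) — decl names and proof terms = the row lanes of qec-search-7 / qec-type-01 (emit_compact_row.side_file).
Every `decide` runs in the kernel (`decide +kernel`); axioms standard; `Elab.async false` (gate memory guard).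
-/

set_option autoImplicit false
set_option Elab.async false

namespace Summit.Ventures.QEC.Census.LP144w5d12

open Summit.Ventures.QEC.Census

set_option maxHeartbeats 400000000 in
/-- Block 1, matrix 1, lane segment `[66, 67)` (768692 lanes, 115 allow-listed stragglers): every selection with largest row there passes (lane engine, KERNEL). -/
theorem psegZ_1_1_17 : Plane.segOK 144 11 (LP144w5d12.cert.sideZ.found.map Prod.fst) LP144w5d12.pG_1_1 5 66 1 4292 = true := by
  decide +kernel
set_option maxHeartbeats 400000000 in
/-- Block 1, matrix 1, lane segment `[67, 68)` (816664 lanes, 118 allow-listed stragglers): every selection with largest row there passes (lane engine, KERNEL). -/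
theorem psegZ_1_1_18 : Plane.segOK 144 11 (LP144w5d12.cert.sideZ.found.map Prod.fst) LP144w5d12.pG_1_1 5 67 1 4292 = true := by
  decide +kernel
set_option maxHeartbeats 400000000 in
/-- Block 1, matrix 1, lane segment `[68, 69)` (866848 lanes, 122 allow-listed stragglers): every selection with largest row there passes (lane engine, KERNEL). -/
theorem psegZ_1_1_19 : Plane.segOK 144 11 (LP144w5d12.cert.sideZ.found.map Prod.fst) LP144w5d12.pG_1_1 5 68 1 4292 = true := by
  decide +kernel
set_option maxHeartbeats 400000000 in
/-- Block 1, matrix 1, lane segment `[69, 70)` (919311 lanes, 62 allow-listed stragglers): every selection with largest row there passes (lane engine, KERNEL). -/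
theorem psegZ_1_1_20 : Plane.segOK 144 11 (LP144w5d12.cert.sideZ.found.map Prod.fst) LP144w5d12.pG_1_1 5 69 1 4292 = true := by
  decide +kernel
end Summit.Ventures.QEC.Census.LP144w5d12
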